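/-
Literature/AlgebraicGeometry/Pohlmann1968/WhiteSporadicSetFieldCube.lean — pub-hodgecm2 (COR-CM), KEPT Literature lane lit-deligne-3
gen 68, file F68h.  THEOREMS ONLY (no `def`, no named fact, no `sorry`, no instance, no notation; D-0026 net debt 0).  HC_CM is NOT proved.
-/
import Literature.NumberTheory.ComplexMultiplication.WhiteSporadicSetCosetCube
import Literature.AlgebraicGeometry.Pohlmann1968.MixedDifferenceCubeAbelianKernels
import HarnessLib

/-!
# White's sporadic set, read on the complex embeddings, is the lane's mixed-difference cube over `F = K^H`

S. P. White, *Sporadic cycles on CM abelian varieties*, Compositio Math. 88 (1993), §4 Lemma 3 and Theorem 3 (p. 131): for an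
abelian CM field `K` with group `G`, an odd character `χ` of `G` with kernel `H` (`G/H` cyclic of order `N`) vanishing on the
type `S`, the element `β = Π_{p∣N}(1 − σ^{N/p})·H ∈ ℚ[G]⁻` has coefficients `0, ±1` and `β = Δ⁻¹ − cΔ⁻¹` exhibits the sporadic
subset `Δ ⊆ G` — a "line" of nondivisorial Hodge classes of codimension `|Δ|/2` on every abelian variety of type `(K; S)`
(Pohlmann's Theorem 1; tree `DegenerateCMTypesAbelianFieldSporadicCycles.exists_exceptional_of_oddCharacter`, where `Δ` is read
on `Hom(K, ℂ)` as `Δ.image (embOf φ₀)`, `σ_g = φ₀ ∘ g⁻¹`).  The lane's gen-67 file `WhiteSporadicSetCosetCube` proved, at the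
level of the group `G`, that `Δ = ⋃_{T ⊆ primes(N)∖{2}} c^{[|T| odd]}·x_T·H` (`χ(x_q) = ζ_q`): a mixed-difference cube of cosets
of `H`.  THIS FILE carries that identification to the field side, where the lane's Hodge classes live
(`MixedDifferenceCubeHodgeClasses`, `MixedDifferenceCubeAbelianKernels`, `MixedDifferenceCubeBasePoints`): with `F = K^H`
(any normal subfield with `Gal(K/F) = ker χ`), base embedding `y = φ₀|_F`, displacements `σ_q = (x_q|_F)⁻¹ ∈ Gal(F/ℚ)` and the
complex conjugation of `F` on the vertices of odd weight,

  `Δ.image (embOf φ₀) = {φ : K → ℂ  |  φ|_F ∈ X(y, σ)}`,   `X(y, σ) = {y_ε ∘ Π_i σ_i^{ε_i} : ε ∈ {0,1}^ι}`,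
  `y_ε = y` (`|ε|` even), `ȳ` (`|ε|` odd)                                                        (`image_embOf_whiteSet_eq`)

— LITERALLY the cube set of `MixedDifferenceCubeAbelianKernels.forall_sum_char_eq_zero_iff_forall_isGaloisBalanced` ∕
`exists_exceptional_of_forall_sum_char_eq_zero` (same expression, `σ_i := (x_i|_F)⁻¹`, `y := φ₀|_F`).  So White's sporadic cycles
(gen 20), Hazama's coset classes `F⁻¹(w)` and the lane's cube classes (gens 65–68, with their kernel criterion and their count
`[F:ℚ]·Π(p_i − 1)/2` per kernel) are the same objects, as a theorem rather than a remark.  Ingredients: the Boolean re-indexing of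
White's vertices (`mem_whiteSet_iff_exists_vertex`, from `WhiteLenstra.mem_whiteSet_iff_exists_coset`), the restriction
dictionary `σ_g|_F = (φ₀|_F) ∘ (g|_F)⁻¹`, `σ_g|_F = σ_v|_F ⟺ v⁻¹g ∈ Gal(K/F)` (`AbelianKernels.embOf_comp_algebraMap_eq_*`), and
`res(c) =` the complex conjugation of `F` (`conjGalRestrict`, `isConj_conjGalRestrict`).  The displacements have the printed
orders: `orderOf (x_q|_F) = q` (`orderOf_restrictNormalHom_eq`), so the census theorem SPECIALISES to White's set: under the kernel
criterion of `forall_sum_char_eq_zero_iff_forall_isGaloisBalanced` the set `Δ.image (embOf φ₀)` is Galois-balanced for `Φ`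
(`isGaloisBalanced_image_embOf_whiteSet` — the two files compose literally).  Elementary; theorems only.  HC_CM is NOT proved and not used.

## Contents

* §1 `mem_whiteSet_iff_exists_vertex` (group level, any finite abelian `G`).
* §2 `restrictNormalHom_conjGal_eq_conjGalRestrict`, `embOf_comp_algebraMap_eq_comp_inv`, `embOf_comp_algebraMap_eq_iff_inv_mul_mem`,
  `orderOf_restrictNormalHom_eq`, **`image_embOf_whiteSet_eq`**, `embOf_mem_cube_iff_mem_whiteSet`, `card_cube_filter_eq_card_whiteSet`,
  `isGaloisBalanced_image_embOf_whiteSet`.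

## References

* [White1993SporadicCycles] S. P. White, Compositio Math. 88 (1993) 123–142, §4 Lemma 3 and Thm. 3 (p. 131), §1 (p. 124).
* [Hazama2003CyclicCM] F. Hazama, J. Math. Sci. Univ. Tokyo 10 (2003), Prop. 3.2, Thm. 4.8 (iv)–(vi), §5.
* [Shimura1998] G. Shimura, *Abelian varieties with complex multiplication and modular functions*, §8.1, §18.2.
* [Pohlmann1968] H. Pohlmann, Ann. of Math. 88 (1968), Thm. 1.

## Provenance

Cell `pub-hodgecm2` (COR-CM), KEPT Literature lane `lit-deligne-3` gen 68 (claim WHITE-DELTA-IS-THE-FIELD-CUBE; count-neutral), file F68h —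
g67 outlook item (a).  Neighbours cited by name: `WhiteSporadicSetCosetCube` (`mem_whiteSet_iff_exists_coset`),
`DegenerateCMTypesAbelianCMFieldCyclicSubfields` (`AbelianKernels.embOf_comp_algebraMap_eq_iff`,
`embOf_comp_algebraMap_eq_embOf_restrictNormalHom`, `restrictNormalHom_eq_one_iff`), `CMTypeRankCharactersNumberField` (`embOf`,
`embOf_bijective`), `CMGaloisSubfield` (`conjGalRestrict`, `isConj_conjGalRestrict`), `DegenerateCMTypesAbelianSporadicSubsets`
(`WhiteLenstra.whiteSet`, `zeta`, `isPrimitiveRoot_zeta`).  Theorems only; net Literature debt 0.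
-/

noncomputable section

open NumberField
open scoped IsMulCommutative Classical

namespace Literature.AlgebraicGeometry.Pohlmann1968

namespace MixedDifferenceCube

open Literature.NumberTheory.ComplexMultiplication
open Literature.NumberTheory.ComplexMultiplication.WhiteLenstra (whiteSet zeta isPrimitiveRoot_zeta mem_whiteSet_iff_exists_coset)
open Literature.AlgebraicGeometry.Motives (CMType)

/-! ## §1 White's vertices indexed by `{0,1}^ι` (group level) -/

section Vertices

variable {G : Type*} [CommGroup G] [Fintype G]

/-- **White's `Δ` through Boolean vertices.**  In the setting of `WhiteLenstra.mem_whiteSet_iff_exists_coset` (`H = ker χ`,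
`χ(ρ) = −1`, `2 ∣ N`), index the odd primes of `N` by `ι` (`q : ι → primes(N) ∖ {2}` a bijection) and pick `x_i` with
`χ(x_i) = ζ_{q_i}`.  Then `g ∈ Δ ⟺ g ∈ ρ^{[|ε| odd]}·(Π_i x_i^{ε_i})·H` for some `ε ∈ {0,1}^ι` — the vertices of the lane's
mixed-difference cube (`(−1)^{|ε|} = Π_i (−1)^{ε_i}`). [cite: White1993SporadicCycles, §4 Lemma 3 and Thm. 3 (proofs, p. 131)]
[cite: Hazama2003CyclicCM, Prop. 3.2] -/
theorem mem_whiteSet_iff_exists_vertex {N : ℕ} (h2 : 2 ∈ N.primeFactors) {χ : AddChar (Additive G) ℂ} {H : Subgroup G}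
    (hker : ∀ g : G, χ (Additive.ofMul g) = 1 ↔ g ∈ H) {ρ : G} (hodd : χ (Additive.ofMul ρ) = -1)
    {ι : Type} [Fintype ι] (q : ι → ℕ) (hqinj : Function.Injective q)
    (hq : ∀ r, (∃ i, q i = r) ↔ r ∈ N.primeFactors.erase 2)
    (x : ι → G) (hx : ∀ i, χ (Additive.ofMul (x i)) = zeta (q i)) {g : G} :
    g ∈ whiteSet N χ ↔ ∃ ε : ι → Bool,
      ((if (∏ i, (if ε i then (-1 : ℤ) else 1)) = 1 then 1 else ρ) * ∏ i, (if ε i then x i else 1))⁻¹ * g ∈ H := by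
  -- White's family on the odd primes of `N`, extended by `1`
  let x' : ℕ → G := fun r => if h : ∃ i, q i = r then x h.choose else 1
  have hx'q : ∀ i, x' (q i) = x i := fun i => by
    have h : ∃ j, q j = q i := ⟨i, rfl⟩
    show (if h : ∃ j, q j = q i then x h.choose else 1) = x i
    rw [dif_pos h, hqinj h.choose_spec]
  have hx' : ∀ r ∈ N.primeFactors.erase 2, χ (Additive.ofMul (x' r)) = zeta r := fun r hr => by
    obtain ⟨i, rfl⟩ := (hq r).2 hr
    rw [hx'q, hx i]
  rw [mem_whiteSet_iff_exists_coset h2 hker hodd x' hx']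
  -- the vertex attached to `T ⊆ primes(N) ∖ {2}` is the vertex attached to `ε = 𝟙_T ∘ q`
  have hvert : ∀ T : Finset ℕ, T ⊆ N.primeFactors.erase 2 → ∀ ε : ι → Bool, (∀ i, ε i = true ↔ q i ∈ T) →
      (if Even T.card then (1 : G) else ρ) * ∏ r ∈ T, x' r =
        (if (∏ i, (if ε i then (-1 : ℤ) else 1)) = 1 then 1 else ρ) * ∏ i, (if ε i then x i else 1) := by
    intro T hT ε hε
    have hTim : T = (Finset.univ.filter fun i => ε i = true).image q := by
      ext r
      simp only [Finset.mem_image, Finset.mem_filter, Finset.mem_univ, true_and]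
      constructor
      · intro hr
        obtain ⟨i, rfl⟩ := (hq r).2 (hT hr)
        exact ⟨i, (hε i).2 hr, rfl⟩
      · rintro ⟨i, hi, rfl⟩
        exact (hε i).1 hi
    have hcard : T.card = (Finset.univ.filter fun i => ε i = true).card := by
      rw [hTim, Finset.card_image_of_injective _ hqinj]
    have hprod : ∏ r ∈ T, x' r = ∏ i, (if ε i then x i else 1) := by
      rw [← Finset.prod_filter, hTim, Finset.prod_image fun i _ j _ h => hqinj h]
      exact Finset.prod_congr rfl fun i _ => hx'q i
    have hsign : (∏ i, (if ε i then (-1 : ℤ) else 1)) = 1 ↔ Even T.card := by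
      rw [← Finset.prod_filter, Finset.prod_const, ← hcard]
      exact neg_one_pow_eq_one_iff_even (by norm_num)
    rw [hprod]
    by_cases he : Even T.card
    · rw [if_pos he, if_pos (hsign.2 he)]
    · rw [if_neg he, if_neg (mt hsign.1 he)]
  constructor
  · rintro ⟨T, hT, hmem⟩
    refine ⟨fun i => decide (q i ∈ T), ?_⟩
    rwa [← hvert T hT (fun i => decide (q i ∈ T)) (fun i => decide_eq_true_iff)]
  · rintro ⟨ε, hmem⟩
    refine ⟨(Finset.univ.filter fun i => ε i = true).image q, ?_, ?_⟩
    · intro r hr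
      obtain ⟨i, -, rfl⟩ := Finset.mem_image.1 hr
      exact (hq (q i)).1 ⟨i, rfl⟩
    · have hε : ∀ i, ε i = true ↔ q i ∈ (Finset.univ.filter fun i => ε i = true).image q := fun i => by
        simp only [Finset.mem_image, Finset.mem_filter, Finset.mem_univ, true_and]
        exact ⟨fun h => ⟨i, h, rfl⟩, fun ⟨j, hj, hji⟩ => hqinj hji ▸ hj⟩
      rwa [hvert _ (fun r hr => by obtain ⟨i, -, rfl⟩ := Finset.mem_image.1 hr; exact (hq (q i)).1 ⟨i, rfl⟩) ε hε]

end Vertices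

/-! ## §2 The field side: `Δ.image (embOf φ₀)` is the cube over `F = K^H` -/

section Field

variable {K : Type} [Field K] [NumberField K] [IsCMField K] [IsAbelianGalois ℚ K]

omit [IsAbelianGalois ℚ K] in
/-- **`res(c)` is the complex conjugation of `F`**: the restriction of the complex conjugation of the CM field `K` to a normal
subfield `F` is `conjGalRestrict F` (complex conjugation under every embedding of `F`). [cite: Shimura1998, §18.2 Lemma (i)] -/
theorem restrictNormalHom_conjGal_eq_conjGalRestrict [IsGalois ℚ K] (F : IntermediateField ℚ K) [Normal ℚ F] :
    AlgEquiv.restrictNormalHom F (conjGal : K ≃ₐ[ℚ] K) = conjGalRestrict F := by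
  refine AlgEquiv.ext fun a => Subtype.ext ?_
  have h1 : algebraMap F K (AlgEquiv.restrictNormalHom F (conjGal : K ≃ₐ[ℚ] K) a) =
      (conjGal : K ≃ₐ[ℚ] K) (algebraMap F K a) :=
    AlgEquiv.restrictNormal_commutes (conjGal : K ≃ₐ[ℚ] K) F a
  rw [coe_conjGalRestrict_apply]
  exact h1

omit [IsCMField K] [IsAbelianGalois ℚ K] in
/-- **`σ_v|_F = (φ₀|_F) ∘ (v|_F)⁻¹`** as a composite of ring maps. [cite: Shimura1998, §8.1] -/
theorem embOf_comp_algebraMap_eq_comp_inv (φ₀ : K →+* ℂ) (F : IntermediateField ℚ K) [Normal ℚ F] (v : K ≃ₐ[ℚ] K) :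
    (embOf φ₀ v).comp (algebraMap F K) =
      (φ₀.comp (algebraMap F K)).comp ((AlgEquiv.restrictNormalHom F v)⁻¹).toRingEquiv.toRingHom := by
  rw [AbelianKernels.embOf_comp_algebraMap_eq_embOf_restrictNormalHom]
  rfl

omit [IsCMField K] in
/-- **`σ_g|_F = σ_v|_F ⟺ v⁻¹ g ∈ Gal(K/F)`** (the fibres of `Hom(K,ℂ) → Hom(F,ℂ)` are the cosets of `Gal(K/F)`).
[cite: Shimura1998, §8.1] -/
theorem embOf_comp_algebraMap_eq_iff_inv_mul_mem (φ₀ : K →+* ℂ) (F : IntermediateField ℚ K) (g v : K ≃ₐ[ℚ] K) :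
    (embOf φ₀ g).comp (algebraMap F K) = (embOf φ₀ v).comp (algebraMap F K) ↔ v⁻¹ * g ∈ F.fixingSubgroup := by
  rw [AbelianKernels.embOf_comp_algebraMap_eq_iff, mul_comm]
  rw [← inv_mem_iff, mul_inv_rev, inv_inv, mul_comm]

omit [IsCMField K] [IsAbelianGalois ℚ K] in
/-- **The orders of the displacements**: if `χ` has kernel `Gal(K/F)` and `χ(x) = ζ_q` (`q` prime), then `x|_F ∈ Gal(F/ℚ)` has
order `q` — White's "`σ^{2m/p}H` has order exactly `p`". [cite: White1993SporadicCycles, §4 Lemma 3 (proof, p. 131)] -/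
theorem orderOf_restrictNormalHom_eq (F : IntermediateField ℚ K) [Normal ℚ F] (χ : AddChar (Additive (K ≃ₐ[ℚ] K)) ℂ)
    (hker : ∀ g : K ≃ₐ[ℚ] K, χ (Additive.ofMul g) = 1 ↔ g ∈ F.fixingSubgroup) {q : ℕ} (hq : q.Prime)
    {x : K ≃ₐ[ℚ] K} (hx : χ (Additive.ofMul x) = zeta q) :
    orderOf (AlgEquiv.restrictNormalHom F x) = q := by
  haveI : Fact q.Prime := ⟨hq⟩
  refine orderOf_eq_prime ?_ ?_
  · rw [← map_pow, AbelianKernels.restrictNormalHom_eq_one_iff, ← hker, ofMul_pow, AddChar.map_nsmul_eq_pow, hx]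
    exact (isPrimitiveRoot_zeta hq.ne_zero).pow_eq_one
  · rw [Ne, AbelianKernels.restrictNormalHom_eq_one_iff, ← hker, hx]
    exact (isPrimitiveRoot_zeta hq.ne_zero).ne_one hq.one_lt

/-- **WHITE'S SPORADIC SET, READ ON THE EMBEDDINGS, IS THE MIXED-DIFFERENCE CUBE OVER `F = K^H`.**  Let `K` be an abelian CM
field, `φ₀ : K → ℂ`, `F ⊆ K` a (normal) subfield, `χ` a character of `Gal(K/ℚ)` with kernel `Gal(K/F)` and `χ(c) = −1`, `N` with
`2 ∣ N` whose odd prime factors are indexed by `q : ι ↪ ℕ`, and `x_i ∈ Gal(K/ℚ)` with `χ(x_i) = ζ_{q_i}` (White's `σ^{N/q_i}`).  Then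
White's `Δ = {β = 1}` (`WhiteLenstra.whiteSet N χ`), transported to `Hom(K, ℂ)` by `g ↦ σ_g = φ₀ ∘ g⁻¹` (as in
`DegenerateCMTypesAbelianFieldSporadicCycles`), is the set of embeddings whose restriction to `F` lies in the cube
`X(y, σ) = {y_ε ∘ Π_i σ_i^{ε_i}}` with base `y = φ₀|_F`, displacements `σ_i = (x_i|_F)⁻¹` (of orders `q_i`,
`orderOf_restrictNormalHom_eq`) and `y_ε = y` or `ȳ` according to the parity of `|ε|` — verbatim the cube set of
`MixedDifferenceCubeAbelianKernels.forall_sum_char_eq_zero_iff_forall_isGaloisBalanced` ∕ `exists_exceptional_of_forall_sum_char_eq_zero`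
and of `MixedDifferenceCubeBasePoints` (whose count of distinct cubes therefore counts White's `Δ`'s).
[cite: White1993SporadicCycles, §4 Lemma 3 and Thm. 3 (proofs, p. 131)] [cite: Hazama2003CyclicCM, Prop. 3.2, Thm. 4.8 (iv)–(vi)]
[cite: Shimura1998, §8.1] -/
theorem image_embOf_whiteSet_eq (φ₀ : K →+* ℂ) (F : IntermediateField ℚ K) [IsAbelianGalois ℚ F]
    (χ : AddChar (Additive (K ≃ₐ[ℚ] K)) ℂ) (hker : ∀ g : K ≃ₐ[ℚ] K, χ (Additive.ofMul g) = 1 ↔ g ∈ F.fixingSubgroup)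
    (hodd : χ (Additive.ofMul (conjGal : K ≃ₐ[ℚ] K)) = -1)
    {N : ℕ} (h2 : 2 ∈ N.primeFactors) {ι : Type} [Fintype ι] (q : ι → ℕ) (hqinj : Function.Injective q)
    (hq : ∀ r, (∃ i, q i = r) ↔ r ∈ N.primeFactors.erase 2)
    (x : ι → K ≃ₐ[ℚ] K) (hx : ∀ i, χ (Additive.ofMul (x i)) = zeta (q i)) :
    (whiteSet N χ).image (embOf φ₀) =
      Finset.univ.filter fun φ : K →+* ℂ => φ.comp (algebraMap F K) ∈
        Finset.univ.image fun ε : ι → Bool =>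
          (if (∏ i, (if ε i then (-1 : ℤ) else 1)) = 1 then φ₀.comp (algebraMap F K)
            else ComplexEmbedding.conjugate (φ₀.comp (algebraMap F K))).comp
            (∏ i, (if ε i then (AlgEquiv.restrictNormalHom F (x i))⁻¹ else 1)).toRingEquiv.toRingHom := by
  -- the complex conjugation of `F` under `y = φ₀|_F`
  have hconj : (φ₀.comp (algebraMap F K)).comp (conjGalRestrict F).toRingEquiv.toRingHom =
      ComplexEmbedding.conjugate (φ₀.comp (algebraMap F K)) := by
    have h := isConj_conjGalRestrict F (φ₀.comp (algebraMap F K))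
    unfold ComplexEmbedding.IsConj at h
    exact h.symm
  have hcc : (conjGal : K ≃ₐ[ℚ] K)⁻¹ = conjGal := inv_eq_of_mul_eq_one_right conjGal_mul_conjGal
  -- the restriction of the vertex `v_ε = c^{[|ε| odd]}·Π x_i^{ε_i}` is the cube point `y_ε ∘ σ_ε`
  have hres : ∀ ε : ι → Bool,
      (embOf φ₀ ((if (∏ i, (if ε i then (-1 : ℤ) else 1)) = 1 then 1 else (conjGal : K ≃ₐ[ℚ] K)) *
          ∏ i, (if ε i then x i else 1))).comp (algebraMap F K) =
        (if (∏ i, (if ε i then (-1 : ℤ) else 1)) = 1 then φ₀.comp (algebraMap F K)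
            else ComplexEmbedding.conjugate (φ₀.comp (algebraMap F K))).comp
          (∏ i, (if ε i then (AlgEquiv.restrictNormalHom F (x i))⁻¹ else 1)).toRingEquiv.toRingHom := by
    intro ε
    rw [embOf_comp_algebraMap_eq_comp_inv, map_mul, mul_inv, map_prod, ← Finset.prod_inv_distrib]
    have hbase : (AlgEquiv.restrictNormalHom F
        (if (∏ i, (if ε i then (-1 : ℤ) else 1)) = 1 then (1 : K ≃ₐ[ℚ] K) else conjGal))⁻¹ =
        if (∏ i, (if ε i then (-1 : ℤ) else 1)) = 1 then (1 : F ≃ₐ[ℚ] F) else conjGalRestrict F := by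
      split_ifs
      · rw [map_one, inv_one]
      · rw [← map_inv, hcc, restrictNormalHom_conjGal_eq_conjGalRestrict]
    have hdisp : ∏ i, (AlgEquiv.restrictNormalHom F (if ε i then x i else 1))⁻¹ =
        ∏ i, (if ε i then (AlgEquiv.restrictNormalHom F (x i))⁻¹ else 1) :=
      Finset.prod_congr rfl fun i _ => by split_ifs <;> simp
    rw [hbase, hdisp]
    have hsplit : ∀ (z : F →+* ℂ) (a b : F ≃ₐ[ℚ] F),
        z.comp (a * b).toRingEquiv.toRingHom = (z.comp a.toRingEquiv.toRingHom).comp b.toRingEquiv.toRingHom :=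
      fun z a b => RingHom.ext fun _ => rfl
    rw [hsplit]
    congr 1
    split_ifs
    · exact RingHom.ext fun _ => rfl
    · exact hconj
  ext φ
  simp only [Finset.mem_image, Finset.mem_filter, Finset.mem_univ, true_and]
  constructor
  · rintro ⟨g, hg, rfl⟩
    obtain ⟨ε, hε⟩ := (mem_whiteSet_iff_exists_vertex h2 hker hodd q hqinj hq x hx).1 hg
    exact ⟨ε, by rw [← hres ε]; exact ((embOf_comp_algebraMap_eq_iff_inv_mul_mem φ₀ F g _).2 hε).symm⟩
  · rintro ⟨ε, hε⟩
    obtain ⟨g, rfl⟩ := (embOf_bijective φ₀).2 φ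
    refine ⟨g, (mem_whiteSet_iff_exists_vertex h2 hker hodd q hqinj hq x hx).2 ⟨ε, ?_⟩, rfl⟩
    rw [← hres ε] at hε
    exact (embOf_comp_algebraMap_eq_iff_inv_mul_mem φ₀ F g _).1 hε.symm

/-- **Pointwise form**: `σ_g|_F ∈ X(φ₀|_F, σ)` iff `g ∈ Δ`. [cite: White1993SporadicCycles, §4 Lemma 3 and Thm. 3 (proofs, p. 131)] -/
theorem embOf_mem_cube_iff_mem_whiteSet (φ₀ : K →+* ℂ) (F : IntermediateField ℚ K) [IsAbelianGalois ℚ F]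
    (χ : AddChar (Additive (K ≃ₐ[ℚ] K)) ℂ) (hker : ∀ g : K ≃ₐ[ℚ] K, χ (Additive.ofMul g) = 1 ↔ g ∈ F.fixingSubgroup)
    (hodd : χ (Additive.ofMul (conjGal : K ≃ₐ[ℚ] K)) = -1)
    {N : ℕ} (h2 : 2 ∈ N.primeFactors) {ι : Type} [Fintype ι] (q : ι → ℕ) (hqinj : Function.Injective q)
    (hq : ∀ r, (∃ i, q i = r) ↔ r ∈ N.primeFactors.erase 2)
    (x : ι → K ≃ₐ[ℚ] K) (hx : ∀ i, χ (Additive.ofMul (x i)) = zeta (q i)) (g : K ≃ₐ[ℚ] K) :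
    (embOf φ₀ g ∈ Finset.univ.filter fun φ : K →+* ℂ => φ.comp (algebraMap F K) ∈
        Finset.univ.image fun ε : ι → Bool =>
          (if (∏ i, (if ε i then (-1 : ℤ) else 1)) = 1 then φ₀.comp (algebraMap F K)
            else ComplexEmbedding.conjugate (φ₀.comp (algebraMap F K))).comp
            (∏ i, (if ε i then (AlgEquiv.restrictNormalHom F (x i))⁻¹ else 1)).toRingEquiv.toRingHom) ↔
      g ∈ whiteSet N χ := by
  rw [← image_embOf_whiteSet_eq φ₀ F χ hker hodd h2 q hqinj hq x hx, (embOf_bijective φ₀).1.mem_finset_image]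

/-- **Cardinality**: the cube fibre set over `F` has `|Δ|` elements (`= 2^{ω(N)−1}·|H|`, `WhiteLenstra.card_whiteSet_card`), i.e. the
codimension of White's class is `|Δ|/2 = 2^{ω(N)−2}|H|·…` as in `DegenerateCMTypesAbelianFieldSporadicCycles` and `2m = 2^k[K:F]`
as in the cube files. [cite: White1993SporadicCycles, §4 Lemma 3 and Thm. 3 (proofs, p. 131)] -/
theorem card_cube_filter_eq_card_whiteSet (φ₀ : K →+* ℂ) (F : IntermediateField ℚ K) [IsAbelianGalois ℚ F]
    (χ : AddChar (Additive (K ≃ₐ[ℚ] K)) ℂ) (hker : ∀ g : K ≃ₐ[ℚ] K, χ (Additive.ofMul g) = 1 ↔ g ∈ F.fixingSubgroup)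
    (hodd : χ (Additive.ofMul (conjGal : K ≃ₐ[ℚ] K)) = -1)
    {N : ℕ} (h2 : 2 ∈ N.primeFactors) {ι : Type} [Fintype ι] (q : ι → ℕ) (hqinj : Function.Injective q)
    (hq : ∀ r, (∃ i, q i = r) ↔ r ∈ N.primeFactors.erase 2)
    (x : ι → K ≃ₐ[ℚ] K) (hx : ∀ i, χ (Additive.ofMul (x i)) = zeta (q i)) :
    (Finset.univ.filter fun φ : K →+* ℂ => φ.comp (algebraMap F K) ∈
        Finset.univ.image fun ε : ι → Bool =>
          (if (∏ i, (if ε i then (-1 : ℤ) else 1)) = 1 then φ₀.comp (algebraMap F K)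
            else ComplexEmbedding.conjugate (φ₀.comp (algebraMap F K))).comp
            (∏ i, (if ε i then (AlgEquiv.restrictNormalHom F (x i))⁻¹ else 1)).toRingEquiv.toRingHom).card =
      (whiteSet N χ).card := by
  rw [← image_embOf_whiteSet_eq φ₀ F χ hker hodd h2 q hqinj hq x hx, Finset.card_image_of_injective _ (embOf_bijective φ₀).1]

/-- **CONSEQUENCE: under the lane's kernel criterion White's `Δ` is a set of Hodge classes.**  In the setting of
`forall_sum_char_eq_zero_iff_forall_isGaloisBalanced` (`K` abelian CM, `F` not totally real, `Gal(K/F)` of index `2·Π_i q_i` with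
cyclic quotient — White's `N = 2m`, `m` odd squarefree), if all characters of kernel `Gal(K/F)` vanish on the type `Φ` (read on
`Gal(K/ℚ)` through `φ₀`), then for every such character `χ` with `χ(c) = −1` and every choice of `x_i` with `χ(x_i) = ζ_{q_i}`, White's
set `Δ.image (embOf φ₀) ⊆ Hom(K, ℂ)` is Galois-balanced for `Φ` (Pohlmann's condition: its weight class is a Hodge class on every
abelian variety of type `(K; Φ)`) — the census theorem applied to the family `σ_i = (x_i|_F)⁻¹` (orders `q_i`) and the base `φ₀|_F`,
read through `image_embOf_whiteSet_eq`. [cite: White1993SporadicCycles, §4 Thm. 3] [cite: Hazama2003CyclicCM, Thm. 4.8 (iv)–(vi)]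
[cite: Pohlmann1968, Thm. 1] -/
theorem isGaloisBalanced_image_embOf_whiteSet (φ₀ : K →+* ℂ) (Φ : CMType K) (F : IntermediateField ℚ K)
    [IsAbelianGalois ℚ F] (hF : ¬ IsTotallyReal F) {ι : Type} [Fintype ι] [Nonempty ι] (q : ι → ℕ)
    (hqinj : Function.Injective q) {N : ℕ} (h2 : 2 ∈ N.primeFactors) (hq : ∀ r, (∃ i, q i = r) ↔ r ∈ N.primeFactors.erase 2)
    (hidx : F.fixingSubgroup.index = 2 * ∏ i, q i) (hcyc : IsCyclic ((K ≃ₐ[ℚ] K) ⧸ F.fixingSubgroup))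
    (hvan : ∀ χ : AddChar (Additive (K ≃ₐ[ℚ] K)) ℂ, (∀ g : K ≃ₐ[ℚ] K, χ (Additive.ofMul g) = 1 ↔ g ∈ F.fixingSubgroup) →
        ∑ s ∈ (Finset.univ.filter fun g : K ≃ₐ[ℚ] K => embOf φ₀ g ∈ Φ.1), χ (Additive.ofMul s) = 0)
    (χ : AddChar (Additive (K ≃ₐ[ℚ] K)) ℂ) (hker : ∀ g : K ≃ₐ[ℚ] K, χ (Additive.ofMul g) = 1 ↔ g ∈ F.fixingSubgroup)
    (hodd : χ (Additive.ofMul (conjGal : K ≃ₐ[ℚ] K)) = -1)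
    (x : ι → K ≃ₐ[ℚ] K) (hx : ∀ i, χ (Additive.ofMul (x i)) = zeta (q i)) :
    IsGaloisBalanced Φ ((whiteSet N χ).image (embOf φ₀)) := by
  have hmem : ∀ i, q i ∈ N.primeFactors.erase 2 := fun i => (hq _).1 ⟨i, rfl⟩
  have hp : ∀ i, (q i).Prime := fun i => Nat.prime_of_mem_primeFactors (Finset.mem_of_mem_erase (hmem i))
  have hodd' : ∀ i, q i ≠ 2 := fun i => Finset.ne_of_mem_erase (hmem i)
  have h := (forall_sum_char_eq_zero_iff_forall_isGaloisBalanced φ₀ Φ F hF hp hqinj hodd' hidx hcyc).1 hvan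
    (fun i => (AlgEquiv.restrictNormalHom F (x i))⁻¹)
    (fun i => by rw [orderOf_inv, orderOf_restrictNormalHom_eq F χ hker (hp i) (hx i)])
    (φ₀.comp (algebraMap F K))
  rwa [← image_embOf_whiteSet_eq φ₀ F χ hker hodd h2 q hqinj hq x hx] at h

end Field

end MixedDifferenceCube

end Literature.AlgebraicGeometry.Pohlmann1968
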